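import Summits.QuantumFields.QCD.Theorems.QuarksAsStableActionStableActionBridgeSoftClosureLimit
import Summits.QuantumFields.YangMills.Theorems.ParabolicTrajectoryContinuumLimitOnTrajectoryStubOSLegsC_Hermitian
import Literature.MathematicalPhysics.QuantumFieldTheory.MassGapFromLatticeClustering
import Literature.MathematicalPhysics.QuantumFieldTheory.QCDOS
import HarnessLib
import Summits.QuantumFields.QCD.Statement

/-!
# Soft OS closure II: OS data of QCD and `QCDOf N_f` from a lattice-side package + the rotation module

Support file for crux `QuarksAsStableAction.StableActionBridge` (item stmt-QuantumFields-9737), line `Sketch`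
(reshape r3b/r3c): the proved composition of the line.

* `isNontrivial_of_labelled_tendsto`, `isNonGaussian_of_labelled_tendsto` — non-triviality / non-Gaussianity of a
  field of the limit OS data from EVENTUAL lattice lower bounds on a truncated two-point function / on `κ₃`;
* `exists_osData_qcd_of_package` — ONE scheme `sch`: a sequence `Λ k` of labelled functionals that IS
  `qcdLatticeSchwinger sch k` on real tensors (P0), with asymptotic scaling + physical branch (P1), a k-uniform E0′
  bound on `⁰𝒮` (P2), full-sequence convergence on `⁰𝒮` (P3), eventual normalisation (P4), asymptotic translation /
  permutation symmetry (P6, P7), eventually approximately positive OS forms (P8), k-uniform spatial clustering (P9),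
  `HasSpeciesCSClustering Δ ∧ HasLatticeMassGap Δ` (P10), the three non-vanishing witnesses (P11), plus the E1
  (rotation) module for `sch` ⟹ `∃ T : OSData, IsQCDAlong sch T ∧ IsNontrivial glue ∧ IsNonGaussian glue ∧
  (∀ f ≠ g, IsNontrivial (pseudoRe f g)) ∧ T.HasMassGap Δ ∧ sch.HasLatticeMassGap Δ` (hermiticity is derived: the tree's labelled KQR Rem. 2.2
  `YangMills…TwoOrbitSynchronisation.osLegsC_isHermitian_of_isReflectionPositive`; continuum gap: tree
  `IsQCDAlong.hasMassGap_of_hasSpeciesCSClustering`);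
* `qcdOf_of_package` — the all-masses version, quantified exactly as the conjunct `QCDOf N_f`.

References: Osterwalder–Schrader II (1975) §2, §4; Glimm–Jaffe 1987 §6.1; Jaffe–Witten 2000 §4–§5.
-/

noncomputable section

open Filter Topology ComplexConjugate
open scoped SchwartzMap
open Literature.MathematicalPhysics.AQFT Literature.MathematicalPhysics.QuantumLattice
open Literature.MathematicalPhysics.QuantumFieldTheory

namespace Summit.QuantumFields.QCD.Cruxes.StableActionBridge.Sketch

/-! ### Non-triviality and non-Gaussianity from eventual lattice lower bounds (generic labels) -/

section Witness

variable {ι : Type} {d : ℕ} [NeZero d]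

/-- **Non-triviality of a field from an eventual lattice lower bound.**  If for some time-ordered one-point
test functions `F, G` and a witness `H` of `ΘF* ⊗ G` the lattice truncated two-point function of species `s`
eventually stays above `ε > 0` in norm, the field `s` of OS data whose Schwinger functions are the limits on
`⁰𝒮` is non-trivial. [cite: JaffeWitten2000, §4] -/
theorem isNontrivial_of_labelled_tendsto :
    ∀ {ι : Type} {d : ℕ} [NeZero d] {Λ : ℕ → LabelledSchwingerFamily ι (EuclideanSpace ℝ (Fin d))} (T : OSData ι d),
      (∀ (n : ℕ) (k : Fin n → ι) (F : 𝓢((Fin n → EuclideanSpace ℝ (Fin d)), ℂ)), IsOffDiagonal F →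
        Tendsto (fun j => Λ j n k F) atTop (𝓝 (T.schwinger n k F))) →
      ∀ {s : ι} (F G : 𝓢((Fin 1 → EuclideanSpace ℝ (Fin d)), ℂ)) (H : 𝓢((Fin (1 + 1) → EuclideanSpace ℝ (Fin d)), ℂ)),
        IsTimeOrdered F → IsTimeOrdered G → IsAppendTensorOf H (osAdjoint F) G → ∀ {ε : ℝ}, 0 < ε →
        (∀ᶠ j in atTop, ε ≤ ‖Λ j (1 + 1) (fun _ => s) H - Λ j 1 (fun _ => s) (osAdjoint F) * Λ j 1 (fun _ => s) G‖) →
        T.IsNontrivial s := by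
  intro ι d _ Λ T hconv s F G H hF hG hH ε hε h
  refine ⟨F, G, H, hF, hG, hH, fun heq => ?_⟩
  have hHo : IsOffDiagonal H := hH.isOffDiagonal_of_isTimeOrdered hF hG
  have hlim : Tendsto (fun j => Λ j (1 + 1) (fun _ => s) H -
      Λ j 1 (fun _ => s) (osAdjoint F) * Λ j 1 (fun _ => s) G) atTop
      (𝓝 (T.schwinger (1 + 1) (fun _ => s) H -
        T.schwinger 1 (fun _ => s) (osAdjoint F) * T.schwinger 1 (fun _ => s) G)) :=
    (hconv _ _ _ hHo).sub ((hconv _ _ _ hF.isOffDiagonal.osAdjoint).mul (hconv _ _ _ hG.isOffDiagonal))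
  have hge : ε ≤ ‖T.schwinger (1 + 1) (fun _ => s) H -
      T.schwinger 1 (fun _ => s) (osAdjoint F) * T.schwinger 1 (fun _ => s) G‖ :=
    ge_of_tendsto hlim.norm h
  rw [heq, sub_self, norm_zero] at hge
  linarith

/-- **Non-Gaussianity of a field from an eventual lattice lower bound on a connected three-point function.**
With tensors `f ⊗ g ⊗ h ∈ ⁰𝒮` and its (off-diagonal) sub-tensors, an eventual lower bound `ε > 0` on the norm of
the lattice `κ₃` passes to the limit data. [cite: GlimmJaffeQP1987, §6.1 (truncated functions)] -/
theorem isNonGaussian_of_labelled_tendsto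
    {Λ : ℕ → LabelledSchwingerFamily ι (EuclideanSpace ℝ (Fin d))} (T : OSData ι d)
    (hconv : ∀ (n : ℕ) (k : Fin n → ι) (F : 𝓢((Fin n → (EuclideanSpace ℝ (Fin d))), ℂ)), IsOffDiagonal F →
      Tendsto (fun j => Λ j n k F) atTop (𝓝 (T.schwinger n k F)))
    {s : ι} (f g h : 𝓢((EuclideanSpace ℝ (Fin d)), ℂ)) (Ffgh : 𝓢((Fin 3 → (EuclideanSpace ℝ (Fin d))), ℂ)) (Fgh Ffh Ffg : 𝓢((Fin 2 → (EuclideanSpace ℝ (Fin d))), ℂ))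
    (Ff Fg Fh : 𝓢((Fin 1 → (EuclideanSpace ℝ (Fin d))), ℂ))
    (h3 : IsTensorOf Ffgh ![f, g, h]) (h3o : IsOffDiagonal Ffgh)
    (hgh : IsTensorOf Fgh ![g, h]) (hfh : IsTensorOf Ffh ![f, h]) (hfg : IsTensorOf Ffg ![f, g])
    (hgho : IsOffDiagonal Fgh) (hfho : IsOffDiagonal Ffh) (hfgo : IsOffDiagonal Ffg)
    (hf : IsTensorOf Ff ![f]) (hg : IsTensorOf Fg ![g]) (hh : IsTensorOf Fh ![h])
    {ε : ℝ} (hε : 0 < ε)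
    (hκ : ∀ᶠ j in atTop, ε ≤ ‖Λ j 3 (fun _ => s) Ffgh - Λ j 1 (fun _ => s) Ff * Λ j 2 (fun _ => s) Fgh
      - Λ j 1 (fun _ => s) Fg * Λ j 2 (fun _ => s) Ffh - Λ j 1 (fun _ => s) Fh * Λ j 2 (fun _ => s) Ffg
      + 2 * (Λ j 1 (fun _ => s) Ff * Λ j 1 (fun _ => s) Fg * Λ j 1 (fun _ => s) Fh)‖) :
    T.IsNonGaussian s := by
  refine ⟨f, g, h, Ffgh, Fgh, Ffh, Ffg, Ff, Fg, Fh, h3, h3o, hgh, hfh, hfg, hf, hg, hh, fun heq => ?_⟩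
  have h1 : ∀ F : 𝓢((Fin 1 → (EuclideanSpace ℝ (Fin d))), ℂ), IsOffDiagonal F := fun F => isOffDiagonal_of_subsingleton F
  set c : (n : ℕ) → 𝓢((Fin n → (EuclideanSpace ℝ (Fin d))), ℂ) → ℂ := fun n F => T.schwinger n (fun _ => s) F with hc
  have hlim : Tendsto (fun j => Λ j 3 (fun _ => s) Ffgh - Λ j 1 (fun _ => s) Ff * Λ j 2 (fun _ => s) Fgh
      - Λ j 1 (fun _ => s) Fg * Λ j 2 (fun _ => s) Ffh - Λ j 1 (fun _ => s) Fh * Λ j 2 (fun _ => s) Ffg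
      + 2 * (Λ j 1 (fun _ => s) Ff * Λ j 1 (fun _ => s) Fg * Λ j 1 (fun _ => s) Fh)) atTop
      (𝓝 (c 3 Ffgh - c 1 Ff * c 2 Fgh - c 1 Fg * c 2 Ffh - c 1 Fh * c 2 Ffg
        + 2 * (c 1 Ff * c 1 Fg * c 1 Fh))) := by
    have e3 := hconv 3 (fun _ => s) Ffgh h3o
    have egh := hconv 2 (fun _ => s) Fgh hgho
    have efh := hconv 2 (fun _ => s) Ffh hfho
    have efg := hconv 2 (fun _ => s) Ffg hfgo
    have ef := hconv 1 (fun _ => s) Ff (h1 Ff)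
    have eg := hconv 1 (fun _ => s) Fg (h1 Fg)
    have eh := hconv 1 (fun _ => s) Fh (h1 Fh)
    exact (((e3.sub (ef.mul egh)).sub (eg.mul efh)).sub (eh.mul efg)).add
      ((ef.mul eg).mul eh |>.const_mul 2)
  have hge := ge_of_tendsto hlim.norm hκ
  have hzero : c 3 Ffgh - c 1 Ff * c 2 Fgh - c 1 Fg * c 2 Ffh - c 1 Fh * c 2 Ffg
      + 2 * (c 1 Ff * c 1 Fg * c 1 Fh) = 0 := heq
  rw [hzero, norm_zero] at hge
  linarith

end Witness


/-- **OS data of QCD along one scheme from the lattice package and the rotation module.**  See the file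
header; every hypothesis is a property of the sequence of lattice functionals `Λ k` (and of the scheme), the
conclusion is the matrix of `QCDOf N_f` at the mass tuple realised by `sch`. [cite: OsterwalderSchraderCMP1975, §2, §4] -/
theorem exists_osData_qcd_of_package {Nf : ℕ} (sch : QCDScheme Nf)
    (Λ : ℕ → LabelledSchwingerFamily (QCDField Nf) (EuclideanSpace ℝ (Fin 4)))
    -- (P0) `Λ k` IS the lattice `n`-point function of the scheme on real tensors, `n ≥ 1`
    (hagree : ∀ (k n : ℕ), n ≠ 0 → ∀ (σ : Fin n → QCDField Nf) (f : Fin n → 𝓢(EuclideanSpace ℝ (Fin 4), ℝ))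
      (F : 𝓢((Fin n → (EuclideanSpace ℝ (Fin 4))), ℂ)), IsTensorOf F (fun i => ofRealTest (f i)) →
      Λ k n σ F = qcdLatticeSchwinger sch k n σ f)
    -- (P1) asymptotic scaling and physical branch
    (hAS : sch.HasAsymptoticScaling) (hbr : ∀ fl : Fin Nf, ∀ᶠ k in atTop, -1 < sch.mq fl k)
    -- (P2) k-uniform E0′ bound on `⁰𝒮`
    {s : ℕ} {α β : ℝ} (hα : 0 ≤ α)
    (hbound : ∀ (n : ℕ) (σ : Fin n → QCDField Nf), ∀ᶠ k in atTop, ∀ F : 𝓢((Fin n → (EuclideanSpace ℝ (Fin 4))), ℂ),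
      IsOffDiagonal F → ‖Λ k n σ F‖ ≤ α * (n.factorial : ℝ) ^ β * schwartzNorm (n * s) F)
    -- (P3) convergence on `⁰𝒮` along the full sequence
    (hconv : ∀ (n : ℕ) (σ : Fin n → QCDField Nf) (F : 𝓢((Fin n → (EuclideanSpace ℝ (Fin 4))), ℂ)), IsOffDiagonal F →
      ∃ c : ℂ, Tendsto (fun k => Λ k n σ F) atTop (𝓝 c))
    -- (P4) eventual normalisation
    (hnorm : ∀ᶠ k in atTop, (Λ k).IsNormalized)
    -- (P6) asymptotic translation invariance on `⁰𝒮`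
    (htrans : ∀ (n : ℕ) (σ : Fin n → QCDField Nf) (a : (EuclideanSpace ℝ (Fin 4))) (F : 𝓢((Fin n → (EuclideanSpace ℝ (Fin 4))), ℂ)), IsOffDiagonal F →
      Tendsto (fun k => Λ k n σ (translateMulti a F) - Λ k n σ F) atTop (𝓝 0))
    -- (P7) asymptotic permutation symmetry on `⁰𝒮`
    (hsymm : ∀ (n : ℕ) (σ : Fin n → QCDField Nf) (π : Equiv.Perm (Fin n)) (F : 𝓢((Fin n → (EuclideanSpace ℝ (Fin 4))), ℂ)),
      IsOffDiagonal F → Tendsto (fun k => Λ k n σ (permTest π F) - Λ k n (σ ∘ π) F) atTop (𝓝 0))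
    -- (P8) eventually approximately positive OS forms
    (hrp : ∀ (N : ℕ) (deg : Fin N → ℕ) (lab : (j : Fin N) → Fin (deg j) → QCDField Nf)
      (F : (j : Fin N) → 𝓢((Fin (deg j) → (EuclideanSpace ℝ (Fin 4))), ℂ)), (∀ j, IsTimeOrdered (F j)) →
      ∀ H : (i j : Fin N) → 𝓢((Fin (deg i + deg j) → (EuclideanSpace ℝ (Fin 4))), ℂ),
        (∀ i j, IsAppendTensorOf (H i j) (osAdjoint (F i)) (F j)) →
        ∀ ε : ℝ, 0 < ε → ∀ᶠ l in atTop,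
          -ε ≤ (∑ i, ∑ j, Λ l (deg i + deg j) (Fin.append (lab i ∘ Fin.rev) (lab j)) (H i j)).re ∧
          |(∑ i, ∑ j, Λ l (deg i + deg j) (Fin.append (lab i ∘ Fin.rev) (lab j)) (H i j)).im| ≤ ε)
    -- (P9) k-uniform spatial clustering
    (hcl : ∀ (n m : ℕ) (σ : Fin n → QCDField Nf) (σ' : Fin m → QCDField Nf) (F : 𝓢((Fin n → (EuclideanSpace ℝ (Fin 4))), ℂ))
      (G : 𝓢((Fin m → (EuclideanSpace ℝ (Fin 4))), ℂ)), IsTimeOrdered F → IsTimeOrdered G → ∀ a : (EuclideanSpace ℝ (Fin 4)), a 0 = 0 → a ≠ 0 →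
      ∀ ε : ℝ, 0 < ε → ∃ t₀ : ℝ, ∀ t : ℝ, t₀ ≤ t → ∀ H : 𝓢((Fin (n + m) → (EuclideanSpace ℝ (Fin 4))), ℂ),
        IsAppendTensorOf H (osAdjoint F) (translateMulti (t • a) G) →
        ∀ᶠ k in atTop, ‖Λ k (n + m) (Fin.append (σ ∘ Fin.rev) σ') H -
          Λ k n (σ ∘ Fin.rev) (osAdjoint F) * Λ k m σ' G‖ ≤ ε)
    -- (P10) species Cauchy–Schwarz clustering and the uniform lattice gap at one rate
    {Δ : ℝ} (hCS : sch.HasSpeciesCSClustering Δ) (hgap : sch.HasLatticeMassGap Δ)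
    -- (P11) eventual lower bounds: glue and flavour-changing pseudoscalar two-point functions, glue `κ₃`
    (hglue : ∃ (F G : 𝓢((Fin 1 → (EuclideanSpace ℝ (Fin 4))), ℂ)) (H : 𝓢((Fin (1 + 1) → (EuclideanSpace ℝ (Fin 4))), ℂ)),
      IsTimeOrdered F ∧ IsTimeOrdered G ∧ IsAppendTensorOf H (osAdjoint F) G ∧ ∃ ε : ℝ, 0 < ε ∧
        ∀ᶠ k in atTop, ε ≤ ‖Λ k (1 + 1) (fun _ => QCDField.glue) H -
          Λ k 1 (fun _ => QCDField.glue) (osAdjoint F) * Λ k 1 (fun _ => QCDField.glue) G‖)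
    (hpseudo : ∀ f g : Fin Nf, f ≠ g → ∃ (F G : 𝓢((Fin 1 → (EuclideanSpace ℝ (Fin 4))), ℂ)) (H : 𝓢((Fin (1 + 1) → (EuclideanSpace ℝ (Fin 4))), ℂ)),
      IsTimeOrdered F ∧ IsTimeOrdered G ∧ IsAppendTensorOf H (osAdjoint F) G ∧ ∃ ε : ℝ, 0 < ε ∧
        ∀ᶠ k in atTop, ε ≤ ‖Λ k (1 + 1) (fun _ => QCDField.pseudoRe f g) H -
          Λ k 1 (fun _ => QCDField.pseudoRe f g) (osAdjoint F) *
            Λ k 1 (fun _ => QCDField.pseudoRe f g) G‖)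
    (hκ₃ : ∃ (f g h : 𝓢(EuclideanSpace ℝ (Fin 4), ℂ)) (Ffgh : 𝓢((Fin 3 → (EuclideanSpace ℝ (Fin 4))), ℂ)) (Fgh Ffh Ffg : 𝓢((Fin 2 → (EuclideanSpace ℝ (Fin 4))), ℂ))
      (Ff Fg Fh : 𝓢((Fin 1 → (EuclideanSpace ℝ (Fin 4))), ℂ)),
      IsTensorOf Ffgh ![f, g, h] ∧ IsOffDiagonal Ffgh ∧ IsTensorOf Fgh ![g, h] ∧ IsTensorOf Ffh ![f, h] ∧
      IsTensorOf Ffg ![f, g] ∧ IsOffDiagonal Fgh ∧ IsOffDiagonal Ffh ∧ IsOffDiagonal Ffg ∧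
      IsTensorOf Ff ![f] ∧ IsTensorOf Fg ![g] ∧ IsTensorOf Fh ![h] ∧ ∃ ε : ℝ, 0 < ε ∧
        ∀ᶠ k in atTop, ε ≤ ‖Λ k 3 (fun _ => QCDField.glue) Ffgh
          - Λ k 1 (fun _ => QCDField.glue) Ff * Λ k 2 (fun _ => QCDField.glue) Fgh
          - Λ k 1 (fun _ => QCDField.glue) Fg * Λ k 2 (fun _ => QCDField.glue) Ffh
          - Λ k 1 (fun _ => QCDField.glue) Fh * Λ k 2 (fun _ => QCDField.glue) Ffg
          + 2 * (Λ k 1 (fun _ => QCDField.glue) Ff * Λ k 1 (fun _ => QCDField.glue) Fg *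
              Λ k 1 (fun _ => QCDField.glue) Fh)‖)
    -- the E1 (rotation) module for this scheme
    (hrot : ∀ S : LabelledSchwingerFamily (QCDField Nf) (EuclideanSpace ℝ (Fin 4)),
      (∀ n : ℕ, n ≠ 0 → ∀ (σ : Fin n → QCDField Nf) (f : Fin n → 𝓢(EuclideanSpace ℝ (Fin 4), ℝ)) (F : 𝓢((Fin n → (EuclideanSpace ℝ (Fin 4))), ℂ)),
        IsTensorOf F (fun i => ofRealTest (f i)) → IsOffDiagonal F →
        Tendsto (fun k => qcdLatticeSchwinger sch k n σ f) atTop (𝓝 (S n σ F))) →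
      ∀ (n : ℕ) (σ : Fin n → QCDField Nf) (R : (EuclideanSpace ℝ (Fin 4)) ≃ₗᵢ[ℝ] (EuclideanSpace ℝ (Fin 4))),
        LinearMap.det (R.toLinearEquiv : (EuclideanSpace ℝ (Fin 4)) →ₗ[ℝ] (EuclideanSpace ℝ (Fin 4))) = 1 →
        ∀ F : 𝓢((Fin n → (EuclideanSpace ℝ (Fin 4))), ℂ), IsOffDiagonal F → S n σ (linActMulti R F) = S n σ F) :
    ∃ T : OSData (QCDField Nf) 4, IsQCDAlong sch T ∧ T.IsNontrivial QCDField.glue ∧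
      T.IsNonGaussian QCDField.glue ∧ (∀ f g : Fin Nf, f ≠ g → T.IsNontrivial (QCDField.pseudoRe f g)) ∧
      T.HasMassGap Δ ∧ sch.HasLatticeMassGap Δ := by
  -- the limit family on `⁰𝒮`, with the E0′ bound everywhere
  obtain ⟨S, hS, hSb⟩ := exists_labelled_tendsto Λ (fun n => α * (n.factorial : ℝ) ^ β) (fun n => n * s)
    (fun n => by positivity) hbound hconv
  -- lattice tensors converge to `S`
  have htensor : ∀ n : ℕ, n ≠ 0 → ∀ (σ : Fin n → QCDField Nf) (f : Fin n → 𝓢(EuclideanSpace ℝ (Fin 4), ℝ))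
      (F : 𝓢((Fin n → (EuclideanSpace ℝ (Fin 4))), ℂ)), IsTensorOf F (fun i => ofRealTest (f i)) → IsOffDiagonal F →
      Tendsto (fun k => qcdLatticeSchwinger sch k n σ f) atTop (𝓝 (S n σ F)) := by
    intro n hn σ f F hF hoff
    refine (hS n σ F hoff).congr' (Eventually.of_forall fun k => ?_)
    exact hagree k n hn σ f F hF
  -- the axioms of `S`
  have h0 : S.IsNormalized := isNormalized_of_labelled_tendsto hS hnorm
  have hE0' : S.HasLinearGrowth :=
    hasLinearGrowth_of_labelled_bound S s α β fun n k F _ => hSb n k F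
  have hE1t : ∀ (n : ℕ) (σ : Fin n → QCDField Nf) (a : (EuclideanSpace ℝ (Fin 4))) (F : 𝓢((Fin n → (EuclideanSpace ℝ (Fin 4))), ℂ)), IsOffDiagonal F →
      S n σ (translateMulti a F) = S n σ F := translate_eq_of_labelled_tendsto hS htrans
  have hE1r := hrot S htensor
  have hE2 : S.IsReflectionPositive := isReflectionPositive_of_labelled_tendsto hS hrp
  -- E0-hermiticity is a consequence of E2 and E0-normalisation (Kravchuk–Qiao–Rychkov Rem. 2.2; tree, YM OSLegsC)
  have h0' : S.IsHermitian :=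
    Summit.QuantumFields.YangMills.Cruxes.ContinuumLimitOnTrajectory.TwoOrbitSynchronisation.osLegsC_isHermitian_of_isReflectionPositive
      S hE2 h0
  have hE3 : S.IsSymmetric := isSymmetric_of_labelled_tendsto hS hsymm
  have hE4 : S.HasClusterProperty := hasClusterProperty_of_labelled_tendsto hS hcl
  obtain ⟨T, hTS⟩ := exists_osData_of_axioms S h0 h0' hE0' hE1t hE1r hE2 hE3 hE4
  -- convergence read on `T`
  have hST : ∀ (n : ℕ) (σ : Fin n → QCDField Nf) (F : 𝓢((Fin n → (EuclideanSpace ℝ (Fin 4))), ℂ)), IsOffDiagonal F →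
      Tendsto (fun k => Λ k n σ F) atTop (𝓝 (T.schwinger n σ F)) := by
    intro n σ F hF; rw [hTS]; exact hS n σ F hF
  have hQCD : IsQCDAlong sch T := by
    refine ⟨hAS, hbr, fun n hn σ f F hF hoff => ?_⟩
    rw [hTS]; exact htensor n hn σ f F hF hoff
  refine ⟨T, hQCD, ?_, ?_, ?_, hQCD.hasMassGap_of_hasSpeciesCSClustering hCS, hgap⟩
  · obtain ⟨F, G, H, hF, hG, hH, ε, hε, hev⟩ := hglue
    exact isNontrivial_of_labelled_tendsto T hST F G H hF hG hH hε hev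
  · obtain ⟨f, g, h, Ffgh, Fgh, Ffh, Ffg, Ff, Fg, Fh, h3, h3o, hgh, hfh, hfg, hgho, hfho, hfgo, hf, hg, hh,
      ε, hε, hev⟩ := hκ₃
    exact isNonGaussian_of_labelled_tendsto T hST f g h Ffgh Fgh Ffh Ffg Ff Fg Fh h3 h3o hgh hfh hfg hgho
      hfho hfgo hf hg hh hε hev
  · intro f g hfg
    obtain ⟨F, G, H, hF, hG, hH, ε, hε, hev⟩ := hpseudo f g hfg
    exact isNontrivial_of_labelled_tendsto T hST F G H hF hG hH hε hev

/-- **`QCDOf N_f` from the lattice package and the rotation module** — the composition of the reshaped line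
`Sketch` of crux `StableActionBridge` (≡ `QCD`), quantified exactly as the conjunct: ONE mass-independent
regularisation `reg` with leading-log mass scaling and chiral gaplessness whose schemes `reg.scheme m z shift`
carry the lattice package of `exists_osData_qcd_of_package` at EVERY positive mass tuple, and the E1 module for
`N_f` flavours (proper-rotation invariance on `⁰𝒮` of the limits of the lattice `n`-point functions of every
asymptotically scaling, physical-branch, uniformly gapped scheme), give `QCDOf N_f`. [cite: JaffeWitten2000, §5] -/
theorem qcdOf_of_package :
    ∀ {Nf : ℕ},
    (∃ reg : QCDRegularisation Nf, reg.HasMassScaling ∧ reg.IsChiralAtZero ∧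
      ∀ m : Fin Nf → ℝ, (∀ f, 0 < m f) → ∃ (z shift : QCDField Nf → ℕ → ℝ)
        (Λ : ℕ → LabelledSchwingerFamily (QCDField Nf) (EuclideanSpace ℝ (Fin 4))),
        (∀ (k n : ℕ), n ≠ 0 → ∀ (σ : Fin n → QCDField Nf) (f : Fin n → 𝓢(EuclideanSpace ℝ (Fin 4), ℝ))
          (F : 𝓢((Fin n → (EuclideanSpace ℝ (Fin 4))), ℂ)), IsTensorOf F (fun i => ofRealTest (f i)) →
          Λ k n σ F = qcdLatticeSchwinger (reg.scheme m z shift) k n σ f) ∧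
        (reg.scheme m z shift).HasAsymptoticScaling ∧
        (∀ fl : Fin Nf, ∀ᶠ k in atTop, -1 < (reg.scheme m z shift).mq fl k) ∧
        (∃ (s : ℕ) (α β : ℝ), 0 ≤ α ∧ ∀ (n : ℕ) (σ : Fin n → QCDField Nf), ∀ᶠ k in atTop,
          ∀ F : 𝓢((Fin n → (EuclideanSpace ℝ (Fin 4))), ℂ), IsOffDiagonal F →
            ‖Λ k n σ F‖ ≤ α * (n.factorial : ℝ) ^ β * schwartzNorm (n * s) F) ∧
        (∀ (n : ℕ) (σ : Fin n → QCDField Nf) (F : 𝓢((Fin n → (EuclideanSpace ℝ (Fin 4))), ℂ)), IsOffDiagonal F →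
          ∃ c : ℂ, Tendsto (fun k => Λ k n σ F) atTop (𝓝 c)) ∧
        (∀ᶠ k in atTop, (Λ k).IsNormalized) ∧
        (∀ (n : ℕ) (σ : Fin n → QCDField Nf) (a : (EuclideanSpace ℝ (Fin 4))) (F : 𝓢((Fin n → (EuclideanSpace ℝ (Fin 4))), ℂ)), IsOffDiagonal F →
          Tendsto (fun k => Λ k n σ (translateMulti a F) - Λ k n σ F) atTop (𝓝 0)) ∧
        (∀ (n : ℕ) (σ : Fin n → QCDField Nf) (π : Equiv.Perm (Fin n)) (F : 𝓢((Fin n → (EuclideanSpace ℝ (Fin 4))), ℂ)),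
          IsOffDiagonal F →
          Tendsto (fun k => Λ k n σ (permTest π F) - Λ k n (σ ∘ π) F) atTop (𝓝 0)) ∧
        (∀ (N : ℕ) (deg : Fin N → ℕ) (lab : (j : Fin N) → Fin (deg j) → QCDField Nf)
          (F : (j : Fin N) → 𝓢((Fin (deg j) → (EuclideanSpace ℝ (Fin 4))), ℂ)), (∀ j, IsTimeOrdered (F j)) →
          ∀ H : (i j : Fin N) → 𝓢((Fin (deg i + deg j) → (EuclideanSpace ℝ (Fin 4))), ℂ),
            (∀ i j, IsAppendTensorOf (H i j) (osAdjoint (F i)) (F j)) →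
            ∀ ε : ℝ, 0 < ε → ∀ᶠ l in atTop,
              -ε ≤ (∑ i, ∑ j, Λ l (deg i + deg j) (Fin.append (lab i ∘ Fin.rev) (lab j)) (H i j)).re ∧
              |(∑ i, ∑ j, Λ l (deg i + deg j) (Fin.append (lab i ∘ Fin.rev) (lab j)) (H i j)).im| ≤ ε) ∧
        (∀ (n m : ℕ) (σ : Fin n → QCDField Nf) (σ' : Fin m → QCDField Nf) (F : 𝓢((Fin n → (EuclideanSpace ℝ (Fin 4))), ℂ))
          (G : 𝓢((Fin m → (EuclideanSpace ℝ (Fin 4))), ℂ)), IsTimeOrdered F → IsTimeOrdered G → ∀ a : (EuclideanSpace ℝ (Fin 4)), a 0 = 0 → a ≠ 0 →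
          ∀ ε : ℝ, 0 < ε → ∃ t₀ : ℝ, ∀ t : ℝ, t₀ ≤ t → ∀ H : 𝓢((Fin (n + m) → (EuclideanSpace ℝ (Fin 4))), ℂ),
            IsAppendTensorOf H (osAdjoint F) (translateMulti (t • a) G) →
            ∀ᶠ k in atTop, ‖Λ k (n + m) (Fin.append (σ ∘ Fin.rev) σ') H -
              Λ k n (σ ∘ Fin.rev) (osAdjoint F) * Λ k m σ' G‖ ≤ ε) ∧
        (∃ Δ : ℝ, 0 < Δ ∧ (reg.scheme m z shift).HasSpeciesCSClustering Δ ∧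
          (reg.scheme m z shift).HasLatticeMassGap Δ) ∧
        (∃ (F G : 𝓢((Fin 1 → (EuclideanSpace ℝ (Fin 4))), ℂ)) (H : 𝓢((Fin (1 + 1) → (EuclideanSpace ℝ (Fin 4))), ℂ)),
          IsTimeOrdered F ∧ IsTimeOrdered G ∧ IsAppendTensorOf H (osAdjoint F) G ∧ ∃ ε : ℝ, 0 < ε ∧
            ∀ᶠ k in atTop, ε ≤ ‖Λ k (1 + 1) (fun _ => QCDField.glue) H -
              Λ k 1 (fun _ => QCDField.glue) (osAdjoint F) * Λ k 1 (fun _ => QCDField.glue) G‖) ∧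
        (∀ f g : Fin Nf, f ≠ g → ∃ (F G : 𝓢((Fin 1 → (EuclideanSpace ℝ (Fin 4))), ℂ)) (H : 𝓢((Fin (1 + 1) → (EuclideanSpace ℝ (Fin 4))), ℂ)),
          IsTimeOrdered F ∧ IsTimeOrdered G ∧ IsAppendTensorOf H (osAdjoint F) G ∧ ∃ ε : ℝ, 0 < ε ∧
            ∀ᶠ k in atTop, ε ≤ ‖Λ k (1 + 1) (fun _ => QCDField.pseudoRe f g) H -
              Λ k 1 (fun _ => QCDField.pseudoRe f g) (osAdjoint F) *
                Λ k 1 (fun _ => QCDField.pseudoRe f g) G‖) ∧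
        (∃ (f g h : 𝓢(EuclideanSpace ℝ (Fin 4), ℂ)) (Ffgh : 𝓢((Fin 3 → (EuclideanSpace ℝ (Fin 4))), ℂ)) (Fgh Ffh Ffg : 𝓢((Fin 2 → (EuclideanSpace ℝ (Fin 4))), ℂ))
          (Ff Fg Fh : 𝓢((Fin 1 → (EuclideanSpace ℝ (Fin 4))), ℂ)),
          IsTensorOf Ffgh ![f, g, h] ∧ IsOffDiagonal Ffgh ∧ IsTensorOf Fgh ![g, h] ∧ IsTensorOf Ffh ![f, h] ∧
          IsTensorOf Ffg ![f, g] ∧ IsOffDiagonal Fgh ∧ IsOffDiagonal Ffh ∧ IsOffDiagonal Ffg ∧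
          IsTensorOf Ff ![f] ∧ IsTensorOf Fg ![g] ∧ IsTensorOf Fh ![h] ∧ ∃ ε : ℝ, 0 < ε ∧
            ∀ᶠ k in atTop, ε ≤ ‖Λ k 3 (fun _ => QCDField.glue) Ffgh
              - Λ k 1 (fun _ => QCDField.glue) Ff * Λ k 2 (fun _ => QCDField.glue) Fgh
              - Λ k 1 (fun _ => QCDField.glue) Fg * Λ k 2 (fun _ => QCDField.glue) Ffh
              - Λ k 1 (fun _ => QCDField.glue) Fh * Λ k 2 (fun _ => QCDField.glue) Ffg
              + 2 * (Λ k 1 (fun _ => QCDField.glue) Ff * Λ k 1 (fun _ => QCDField.glue) Fg *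
                  Λ k 1 (fun _ => QCDField.glue) Fh)‖)) →
    (∀ sch : QCDScheme Nf, sch.HasAsymptoticScaling →
      (∀ fl : Fin Nf, ∀ᶠ k in atTop, -1 < sch.mq fl k) → (∃ Δ : ℝ, 0 < Δ ∧ sch.HasLatticeMassGap Δ) →
      ∀ S : LabelledSchwingerFamily (QCDField Nf) (EuclideanSpace ℝ (Fin 4)),
        (∀ n : ℕ, n ≠ 0 → ∀ (σ : Fin n → QCDField Nf) (f : Fin n → 𝓢(EuclideanSpace ℝ (Fin 4), ℝ)) (F : 𝓢((Fin n → (EuclideanSpace ℝ (Fin 4))), ℂ)),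
          IsTensorOf F (fun i => ofRealTest (f i)) → IsOffDiagonal F →
          Tendsto (fun k => qcdLatticeSchwinger sch k n σ f) atTop (𝓝 (S n σ F))) →
        ∀ (n : ℕ) (σ : Fin n → QCDField Nf) (R : (EuclideanSpace ℝ (Fin 4)) ≃ₗᵢ[ℝ] (EuclideanSpace ℝ (Fin 4))),
          LinearMap.det (R.toLinearEquiv : (EuclideanSpace ℝ (Fin 4)) →ₗ[ℝ] (EuclideanSpace ℝ (Fin 4))) = 1 →
          ∀ F : 𝓢((Fin n → (EuclideanSpace ℝ (Fin 4))), ℂ), IsOffDiagonal F → S n σ (linActMulti R F) = S n σ F) →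
    QCDOf Nf := by
  intro Nf hpkg hrot
  obtain ⟨reg, hms, hχ, hall⟩ := hpkg
  refine ⟨reg, hms, hχ, fun m hm => ?_⟩
  obtain ⟨z, shift, Λ, hagree, hAS, hbr, ⟨s, α, β, hα, hbound⟩, hconv, hnorm, htrans, hsymm, hrp, hcl,
    ⟨Δ, hΔ, hCS, hgap⟩, hglue, hpseudo, hκ₃⟩ := hall m hm
  obtain ⟨T, hQCD, hnt, hng, hps, hTgap, hLgap⟩ :=
    exists_osData_qcd_of_package (reg.scheme m z shift) Λ hagree hAS hbr hα hbound hconv hnorm htrans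
      hsymm hrp hcl hCS hgap hglue hpseudo hκ₃ (hrot (reg.scheme m z shift) hAS hbr ⟨Δ, hΔ, hgap⟩)
  exact ⟨z, shift, T, hQCD, hnt, hng, hps, Δ, hΔ, hTgap, hLgap⟩

end Summit.QuantumFields.QCD.Cruxes.StableActionBridge.Sketch

end
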